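import Summits.QuantumFields.BalabanUV.Beta.MultiscaleParametrix
import Summits.QuantumFields.BalabanUV.Beta.MultiscaleDecay

/-!
# Beta / MultiscaleParametrixTorus — NODES (w4-b′)/(w4-c′) OF THE O.2 SKELETON §8.9: THE LEVEL-FREE REMAINDER BOUND AND THE
# PARAMETRIX FOR THE MULTI-REGION OPERATOR ON THE TORUS WITH A COVERING CUBE FAMILY (MODEL; the instance of
# `MultiscaleRemainderL2` / `MultiscaleParametrix` in the vocabulary of `MultiscaleDecay`)

Torus `UT N`; the operator `A = levelOp bsrc btgt c Rm (l x ↦ corner of the S_l-cube of x) (l x ↦ ω_l(corner)) T a` of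
`MultiscaleDecay` (isometric `Rm`, `T`; `a ≥ 0`; level weights `ω_l` supported on the level-`l` cells of a pairwise-disjoint
COVERING cube family, `hsupp`); a cell-sum coercivity with constant `C > 0` (discharged at `U = 1` by (D)
`multiscale_coercive_torus_flat`, covariantly by (H)).  Then:
* §1 **`local_coercive`**: a field vanishing off a hull `Ω₀ = {χ = 1}` whose sites have scale `≤ n_H` obeys
  `C·n_H⁻²·Σf² ≤ ⟨f, Af⟩` — the LOCAL coercivity of the Dirichlet problem on the hull (constant `C/n_H²`, hull- and
  level-count-free); `posDef_of_coercive`;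
* §2 **`blockConst_of_cellConst`**: a hull that is a union of family cells is constant on the weighted part of every averaging
  block (clause (b) of `MultiscaleParametrix`);
* §3 **`remainder_le_torus`**: for a bump `h` (`|h| ≤ 1`, `|c∂h| ≤ θ`, `|Δ_c h| ≤ Θ₂`, oscillation `≤ m_l` on the weighted
  level-`l` blocks) carried with its bond-neighbourhood by such a hull:
  `‖K(h)G′_{Ω₀}M_h‖_{ℓ²} ≤ 2θ√d·n_H/√C + (Θ₂ + Σ_l |a_l|·2ω̄_l²S_l^d·m_l)·n_H²/C` (`MultiscaleRemainderL2.l2Bound_remK_dirInv`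
  BY NAME), and **`remainder_le_torus_adapted`**: with SCALE-ADAPTED data — box scale `n_z`, `n_H ≤ L·n_z`,
  `θ = c_maxC₁/(M n_z)`, `Θ₂ = c_max²C₂/(M n_z)²`, `Σ_l |a_l|·2ω̄_l²S_l^d·m_l ≤ 2a_maxC₃/(M n_z²)` — the bound is **`C_rem/M`,
  `C_rem = 2c_maxC₁√d·L/√C + c_max²C₂L²/C + 2a_maxC₃L²/C`**, seeing `d, c_max, a_max, C, L, C₁, C₂, C₃` ONLY: uniform in the
  box scale, the levels, their number and the volume ([B6] (2.40) / [B9] (3.89) SHAPE «O(M⁻¹)»);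
* §4 **`parametrix_torus_adapted`**: a finite family of such boxes with `Σ_z h_z² = 1` and at most `ν` hulls through a site,
  `M > ν·C_rem` ⟹ `1 − R′` is a unit, `A⁻¹ = G′₀(1 − R′)⁻¹`, `‖(1 − R′)⁻¹‖_{ℓ²} ≤ (1 − νC_rem/M)⁻¹`
  (`MultiscaleParametrix.parametrix_levelOp` BY NAME) — the Thm 3.7 / (2.38) resolvent with a LEVEL-FREE «M sufficiently
  large» (unit `b2b-balaban-beta-d4-p2`, GEN 9, MODEL crew; O.2 skeleton v1.4.1 §8.9 (w4-b′)/(w4-c′)).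

HONEST FRAMING: discharging `BetaPertH` makes Bałaban's UV stability UNCONDITIONAL — NOT the continuum limit, NOT the
Clay problem.  HONEST DEPENDENCY (verbatim): «continuum YM on T⁴ ⇐ BetaPertH ∧ nine spine estimates (0/9 proved);
BetaPertH ⇐ (D1) ∧ (D4) ∧ CAP+tail; G-an2-4 gates asym, D1 and NE2/3/4.»  THIS MODULE DISCHARGES NOTHING of `BetaPertH`,
asserts NOTHING printed and cites nothing as a fact (ABSOLUTE RULE): [folklore] bookkeeping about the pv21 component MODEL;
the bumps `h_z`, hulls `χ_z` and their scale-adapted bounds are DATA here (their EXISTENCE on a concrete graded family is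
node (w4-a′), separate, like every instance datum of this lineage); print's `c ≡ η⁻¹` is constant while `c` is general here.
LOCI (shape only): [B9] = `Balaban1985BackgroundPropagators` (3.87)–(3.90) pp. 408–409, Thm 3.7, (3.42) p. 397; [B6] =
`Balaban1984PropagatorsII` (2.36)–(2.44) pp. 229–230; [B5] = `Balaban1984PropagatorsI` (1.118) p. 37.  No class change on
row D4 (critical-path width 0; D4 DISCHARGE NO DATE); NOT BetaPertH, NOT continuum, NOT Clay, NOT summit progress.
-/

namespace Summit.QuantumFields.BalabanUV.Beta.MultiscaleParametrixTorus

open Finset Function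
open Summit.QuantumFields.BalabanUV.Beta.BoxPoincare (Box)
open Summit.QuantumFields.BalabanUV.Beta.MultiscaleCoerciveTorus
open Summit.QuantumFields.BalabanUV.Beta.MultiscaleDecayBudget
open Summit.QuantumFields.BalabanUV.Beta.MultiscaleConjError (siteSq siteSq_nonneg)
open Literature.MathematicalPhysics.QuantumFieldTheory.Balaban1983to89
open B9Thm37Sum B9Thm37Glue B9Thm37GlueTorusInv
open Literature.MathematicalPhysics.QuantumFieldTheory.Balaban1983to89.B9Thm37GluePU (bsrc btgt bsrc_apply btgt_apply)
open Literature.MathematicalPhysics.QuantumFieldTheory.Balaban1983to89.B9Thm37GlueTorusCov (tblk)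
open Literature.MathematicalPhysics.QuantumFieldTheory.Balaban1983to89.B9Thm37GlueTorusCovLevels (levelOp levelSum)
open Literature.MathematicalPhysics.QuantumFieldTheory.Balaban1983to89.B9Thm37GlueTorusCovCT (card_filter_bsrc_le
  card_filter_btgt_le)
open B5TorusCover (UT Ctr ctrU)
open Summit.QuantumFields.BalabanUV.Beta.CovariantTowerL2
open Summit.QuantumFields.BalabanUV.Beta.MultiscaleRemainderLeibniz
open Summit.QuantumFields.BalabanUV.Beta.MultiscaleRemainderL2
open Summit.QuantumFields.BalabanUV.Beta.MultiscaleParametrix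

noncomputable section

variable {d : ℕ} {N : Fin d → ℕ} [∀ i, NeZero (N i)] {Cp J K : Type} [Fintype Cp] [DecidableEq Cp] [Fintype J]
  [Fintype K] (S : J → ℕ) (hS : ∀ l, 1 ≤ S l) (hdivS : ∀ l i, S l ∣ N i) (lvl : K → J) (zc : (k : K) → Ctr N (S (lvl k)))

/-! ## §1  Local coercivity on a hull and strict positivity from the cell-sum coercivity -/

section Local

omit [DecidableEq Cp] [Fintype J] in
/-- **LOCAL COERCIVITY ON A HULL (MODEL)**: a cell-sum coercivity `C·Σ_k S_{l_k}⁻²‖f‖²_{cell k} ≤ ⟨f, Af⟩` on a disjoint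
covering family, and a field `f` vanishing off `Ω₀ = {χ = 1}` all of whose sites have scale `≤ n_H` ⟹
`C·n_H⁻²·Σ_p f(p)² ≤ ⟨f, Af⟩` — the Dirichlet problem on a hull of cells of scale `≤ n_H` is coercive with constant `C/n_H²`,
independent of the hull and of the number of levels ([B9] Thm 3.1 / [B6] (2.43) SHAPE for G′(□)).
[cite: Balaban1985BackgroundPropagators, (3.24) p.394 + Thm 3.1 p.397; Balaban1984PropagatorsII, (2.43) p.230] -/
theorem local_coercive (hdisj : ∀ k k' v v', cellPt S hS hdivS lvl zc k v = cellPt S hS hdivS lvl zc k' v' → k = k')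
    (hcover : ∀ x : UT N, ∃ k, ∃ v : Box d (S (lvl k)), cellPt S hS hdivS lvl zc k v = x)
    (A : Module.End ℝ (UT N × Cp → ℝ)) {C : ℝ} (hC : 0 ≤ C)
    (hcoer : ∀ f : UT N × Cp → ℝ,
      C * ∑ k, ((S (lvl k) : ℝ) ^ 2)⁻¹ * ∑ v : Box d (S (lvl k)), ∑ i, f (cellPt S hS hdivS lvl zc k v, i) ^ 2 ≤ ∑ p, f p * A f p)
    (χ : UT N → ℝ) {nH : ℕ} (hH : ∀ x, χ x = 1 → siteScale S hS hdivS lvl zc hcover x ≤ nH)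
    (hχ : ∀ x, χ x = 0 ∨ χ x = 1) (f : UT N × Cp → ℝ) (hf : ∀ p : UT N × Cp, (χ ∘ Prod.fst) p = 0 → f p = 0) :
    C * ((nH : ℝ) ^ 2)⁻¹ * ∑ p, f p ^ 2 ≤ ∑ p, f p * A f p := by
  have h1 : C * ∑ x, ((siteScale S hS hdivS lvl zc hcover x : ℝ) ^ 2)⁻¹ * siteSq f x ≤ ∑ p, f p * A f p := by
    rw [← sum_cells_scale_eq S hS hdivS lvl zc hdisj hcover (siteSq f)]
    exact hcoer f
  refine le_trans ?_ h1
  rw [mul_assoc]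
  refine mul_le_mul_of_nonneg_left ?_ hC
  rw [← sum_site_sq, Finset.mul_sum]
  refine Finset.sum_le_sum fun x _ => ?_
  rcases hχ x with h0 | h1x
  · have hz : siteSq f x = 0 := Finset.sum_eq_zero fun i _ => by rw [hf (x, i) h0]; ring
    have hz' : ∑ k, f (x, k) ^ 2 = 0 := hz
    rw [hz, hz', mul_zero, mul_zero]
  · have hn1 : (1 : ℝ) ≤ siteScale S hS hdivS lvl zc hcover x := by
      exact_mod_cast one_le_siteScale S hS hdivS lvl zc hcover x
    have hnle : (siteScale S hS hdivS lvl zc hcover x : ℝ) ≤ nH := by exact_mod_cast hH x h1x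
    have hle : ((nH : ℝ) ^ 2)⁻¹ ≤ ((siteScale S hS hdivS lvl zc hcover x : ℝ) ^ 2)⁻¹ :=
      inv_anti₀ (by positivity) (pow_le_pow_left₀ (by linarith) hnle 2)
    exact mul_le_mul_of_nonneg_right hle (siteSq_nonneg f x)

omit [DecidableEq Cp] [Fintype J] in
/-- A cell-sum coercivity with `C > 0` on a disjoint covering family makes the operator strictly positive (the positivity half
of `MultiscaleDecay.isUnit_of_coercive`, exported). [folklore] -/
theorem posDef_of_coercive (hdisj : ∀ k k' v v', cellPt S hS hdivS lvl zc k v = cellPt S hS hdivS lvl zc k' v' → k = k')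
    (hcover : ∀ x : UT N, ∃ k, ∃ v : Box d (S (lvl k)), cellPt S hS hdivS lvl zc k v = x)
    (A : Module.End ℝ (UT N × Cp → ℝ)) {C : ℝ} (hC : 0 < C)
    (hcoer : ∀ f : UT N × Cp → ℝ,
      C * ∑ k, ((S (lvl k) : ℝ) ^ 2)⁻¹ * ∑ v : Box d (S (lvl k)), ∑ i, f (cellPt S hS hdivS lvl zc k v, i) ^ 2 ≤ ∑ p, f p * A f p)
    (f : UT N × Cp → ℝ) (hf : f ≠ 0) : 0 < ∑ p, f p * A f p := by
  have h : C * ∑ x, ((siteScale S hS hdivS lvl zc hcover x : ℝ) ^ 2)⁻¹ * siteSq f x ≤ ∑ p, f p * A f p := by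
    rw [← sum_cells_scale_eq S hS hdivS lvl zc hdisj hcover (siteSq f)]
    exact hcoer f
  refine lt_of_lt_of_le ?_ h
  obtain ⟨⟨x₀, i₀⟩, hx₀⟩ := Function.ne_iff.mp hf
  refine mul_pos hC (lt_of_lt_of_le ?_ (Finset.single_le_sum
    (f := fun x => ((siteScale S hS hdivS lvl zc hcover x : ℝ) ^ 2)⁻¹ * siteSq f x)
    (fun x _ => mul_nonneg (inv_nonneg.mpr (sq_nonneg _)) (siteSq_nonneg f x)) (mem_univ x₀)))
  have hn : (0 : ℝ) < siteScale S hS hdivS lvl zc hcover x₀ := by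
    exact_mod_cast one_le_siteScale S hS hdivS lvl zc hcover x₀
  refine mul_pos (inv_pos.mpr (pow_pos hn 2)) ?_
  exact lt_of_lt_of_le (lt_of_le_of_ne (sq_nonneg (f (x₀, i₀))) (Ne.symm (pow_ne_zero 2 hx₀)))
    (Finset.single_le_sum (f := fun i => f (x₀, i) ^ 2) (fun i _ => sq_nonneg _) (mem_univ i₀))

end Local

/-! ## §2  Hulls that are unions of family cells are block-constant on the weighted sites -/

section Hull

omit [Fintype Cp] [DecidableEq Cp] [Fintype J] [Fintype K] in
/-- **Clause (b) on the torus**: if `χ` is constant on every family cell (the hull is a union of cells) and the level weights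
live on family cells (`hsupp`), then at every site with `ω_l ≠ 0` the value `χ(x)` equals `χ` at the corner label of the
level-`l` block of `x`. [folklore] -/
theorem blockConst_of_cellConst (ω : J → UT N → ℝ)
    (hsupp : ∀ l x, ω l (ctrU N (S l) (tblk (hS l) (hdivS l) x)) ≠ 0 → ∃ k v, lvl k = l ∧ cellPt S hS hdivS lvl zc k v = x)
    (χ : UT N → ℝ) (hχcell : ∀ k v, χ (cellPt S hS hdivS lvl zc k v) = χ (ctrU N (S (lvl k)) (zc k))) (l : J) (x : UT N)
    (hx : ω l (ctrU N (S l) (tblk (hS l) (hdivS l) x)) ≠ 0) : χ x = χ (ctrU N (S l) (tblk (hS l) (hdivS l) x)) := by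
  obtain ⟨k, v, hkl, hkv⟩ := hsupp l x hx
  subst hkl
  rw [← hkv, hχcell k v]
  congr 2
  rw [cellPt, tblk_cubePt]

end Hull

/-! ## §3  The level-free remainder bound on the torus -/

section Remainder

variable (Rm : UT N × Fin d → Cp → Cp → ℝ) (T : J → UT N → Cp → Cp → ℝ) (a : J → ℝ) (ω : J → UT N → ℝ)
  (c : UT N × Fin d → ℝ)

/-- **THE REMAINDER TERM ON THE TORUS (MODEL; node (w4-b′)).**  The operator of `MultiscaleDecay` with a cell-sum coercivity
`C > 0`; level weights with `|ω_l| ≤ ω̄_l` (`ω̄_l ≥ 0`); a hull `Ω₀ = {χ = 1}` that is a union of family cells of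
scale `≤ n_H`; a bump `h` with `supp h ⊆ Ω₀` together with its bond-neighbourhood, `|h| ≤ 1`, `|c∂h| ≤ θ`, `|Δ_c h| ≤ Θ₂` and
oscillation `|h(x) − h(corner)| ≤ m_l` on the weighted level-`l` blocks:
`‖K(h)G′_{Ω₀}M_h‖_{ℓ²} ≤ 2θ√d·(√(C·n_H⁻²))⁻¹ + (Θ₂ + Σ_l |a_l|·2ω̄_l²S_l^d·m_l)·(C·n_H⁻²)⁻¹`.
[cite: Balaban1985BackgroundPropagators, (3.88)–(3.89) p.409; Balaban1984PropagatorsII, (2.39)–(2.40) pp.229–230] -/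
theorem remainder_le_torus (hdisj : ∀ k k' v v', cellPt S hS hdivS lvl zc k v = cellPt S hS hdivS lvl zc k' v' → k = k')
    (hcover : ∀ x : UT N, ∃ k, ∃ v : Box d (S (lvl k)), cellPt S hS hdivS lvl zc k v = x)
    (hRm : ∀ b i j, ∑ k, Rm b k i * Rm b k j = if i = j then (1 : ℝ) else 0)
    (hT : ∀ l x i i', ∑ k, T l x k i * T l x k i' = if i = i' then (1 : ℝ) else 0) (ha : ∀ j, 0 ≤ a j)
    {wmax : J → ℝ} (hw0 : ∀ l, 0 ≤ wmax l) (hw : ∀ l x, |ω l (ctrU N (S l) (tblk (hS l) (hdivS l) x))| ≤ wmax l)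
    {C : ℝ} (hC : 0 < C)
    (hcoer : ∀ f : UT N × Cp → ℝ,
      C * ∑ k, ((S (lvl k) : ℝ) ^ 2)⁻¹ * ∑ v : Box d (S (lvl k)), ∑ i, f (cellPt S hS hdivS lvl zc k v, i) ^ 2 ≤
        ∑ p, f p * levelOp bsrc btgt c Rm (fun l x => ctrU N (S l) (tblk (hS l) (hdivS l) x))
          (fun l x => ω l (ctrU N (S l) (tblk (hS l) (hdivS l) x))) T a f p)
    (χ : UT N → ℝ) (hχ : ∀ x, χ x = 0 ∨ χ x = 1) {nH : ℕ} (hnH : 1 ≤ nH)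
    (hH : ∀ x, χ x = 1 → siteScale S hS hdivS lvl zc hcover x ≤ nH)
    (h : UT N → ℝ) (hh : ∀ x, |h x| ≤ 1) {θ : ℝ} (hθ : 0 ≤ θ) (hdh : ∀ b, |c b * (h (btgt b) - h (bsrc b))| ≤ θ)
    {Θ₂ : ℝ} (hΘ₂ : 0 ≤ Θ₂) (hlap : ∀ x, |lapH bsrc btgt c h x| ≤ Θ₂) {m : J → ℝ} (hm : ∀ l, 0 ≤ m l)
    (hosc : ∀ l x, ω l (ctrU N (S l) (tblk (hS l) (hdivS l) x)) ≠ 0 → |h x - h (ctrU N (S l) (tblk (hS l) (hdivS l) x))| ≤ m l) :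
    L2Bound (remK bsrc btgt c Rm (levelSum (fun l x => ctrU N (S l) (tblk (hS l) (hdivS l) x))
          (fun l x => ω l (ctrU N (S l) (tblk (hS l) (hdivS l) x))) T a) h *
        dirInv (levelOp bsrc btgt c Rm (fun l x => ctrU N (S l) (tblk (hS l) (hdivS l) x))
          (fun l x => ω l (ctrU N (S l) (tblk (hS l) (hdivS l) x))) T a) (χ ∘ Prod.fst) * mulOp (h ∘ Prod.fst))
      (2 * (θ * Real.sqrt d) * (Real.sqrt (C * ((nH : ℝ) ^ 2)⁻¹))⁻¹ +
        (Θ₂ + ∑ l, |a l| * (2 * (wmax l ^ 2 * ((S l ^ d : ℕ) : ℝ)) * m l)) * (C * ((nH : ℝ) ^ 2)⁻¹)⁻¹) := by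
  set A := levelOp bsrc btgt c Rm (fun l x => ctrU N (S l) (tblk (hS l) (hdivS l) x))
    (fun l x => ω l (ctrU N (S l) (tblk (hS l) (hdivS l) x))) T a with hA
  have hpos := posDef_of_coercive S hS hdivS lvl zc hdisj hcover A hC hcoer
  have hnH0 : (0 : ℝ) < nH := by exact_mod_cast hnH
  have hlam : 0 < C * ((nH : ℝ) ^ 2)⁻¹ := mul_pos hC (inv_pos.mpr (pow_pos hnH0 2))
  have hloc := local_coercive S hS hdivS lvl zc hdisj hcover A hC.le hcoer χ hH hχ
  exact l2Bound_remK_dirInv bsrc btgt c Rm (fun l x => ctrU N (S l) (tblk (hS l) (hdivS l) x))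
    (fun l x => ω l (ctrU N (S l) (tblk (hS l) (hdivS l) x))) T hRm hT ha hpos (fun p => hχ p.1) hlam hloc
    card_filter_bsrc_le card_filter_btgt_le h hh hθ hdh hΘ₂ hlap hw0 hw
    (n := fun l => S l ^ d) (fun l β => card_block_le (hS l) (hdivS l) β) (fun _ β => h β) hm hosc

omit [∀ i, NeZero (N i)] [Fintype Cp] [DecidableEq Cp] [Fintype J] [Fintype K] in
/-- Arithmetic of the scale-adapted data: with `1 ≤ M`, `1 ≤ n_z`, `1 ≤ L`, `n_H ≤ L·n_z`, `θ = c_maxC₁/(M n_z)`,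
`Θ₂ = c_max²C₂/(M n_z)²`, `Γ ≤ 2a_maxC₃/(M n_z²)` (all constants `≥ 0`, `C > 0`):
`2θ√d·(√(C n_H⁻²))⁻¹ + (Θ₂ + Γ)·(C n_H⁻²)⁻¹ ≤ C_rem/M`, `C_rem = 2c_maxC₁√d·L/√C + c_max²C₂L²/C + 2a_maxC₃L²/C`. [folklore] -/
theorem adapted_arith {M nz L nH C cmax amax C₁ C₂ C₃ dd Γ : ℝ} (hM : 1 ≤ M) (hnz : 1 ≤ nz) (hL : 1 ≤ L) (hnH0 : 0 < nH)
    (hnH : nH ≤ L * nz) (hC : 0 < C) (hcmax : 0 ≤ cmax) (hamax : 0 ≤ amax) (hC₁ : 0 ≤ C₁) (hC₂ : 0 ≤ C₂) (hC₃ : 0 ≤ C₃)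
    (hΓ : Γ ≤ 2 * amax * C₃ / (M * nz ^ 2)) :
    2 * (cmax * C₁ / (M * nz) * Real.sqrt dd) * (Real.sqrt (C * (nH ^ 2)⁻¹))⁻¹ +
        (cmax ^ 2 * C₂ / (M * nz) ^ 2 + Γ) * (C * (nH ^ 2)⁻¹)⁻¹ ≤
      (2 * cmax * C₁ * Real.sqrt dd * L / Real.sqrt C + cmax ^ 2 * C₂ * L ^ 2 / C + 2 * amax * C₃ * L ^ 2 / C) / M := by
  have hM0 : 0 < M := by linarith
  have hnz0 : 0 < nz := by linarith
  have hL0 : 0 < L := by linarith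
  have hsC : 0 < Real.sqrt C := Real.sqrt_pos.mpr hC
  -- simplify the two inverse factors
  have e1 : (Real.sqrt (C * (nH ^ 2)⁻¹))⁻¹ = nH / Real.sqrt C := by
    rw [Real.sqrt_mul hC.le, Real.sqrt_inv, Real.sqrt_sq hnH0.le, mul_inv, inv_inv, div_eq_mul_inv, mul_comm]
  have e2 : (C * (nH ^ 2)⁻¹)⁻¹ = nH ^ 2 / C := by rw [mul_inv, inv_inv, div_eq_mul_inv, mul_comm]
  rw [e1, e2]
  -- first term
  have t1 : 2 * (cmax * C₁ / (M * nz) * Real.sqrt dd) * (nH / Real.sqrt C) ≤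
      2 * cmax * C₁ * Real.sqrt dd * L / Real.sqrt C / M := by
    have hnum : 2 * (cmax * C₁ / (M * nz) * Real.sqrt dd) * (nH / Real.sqrt C) =
        (2 * cmax * C₁ * Real.sqrt dd / Real.sqrt C / M) * (nH / nz) := by
      field_simp
    rw [hnum]
    have hratio : nH / nz ≤ L := by rw [div_le_iff₀ hnz0]; exact hnH
    have hpre : 0 ≤ 2 * cmax * C₁ * Real.sqrt dd / Real.sqrt C / M := by positivity
    calc (2 * cmax * C₁ * Real.sqrt dd / Real.sqrt C / M) * (nH / nz)
        ≤ (2 * cmax * C₁ * Real.sqrt dd / Real.sqrt C / M) * L := mul_le_mul_of_nonneg_left hratio hpre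
      _ = 2 * cmax * C₁ * Real.sqrt dd * L / Real.sqrt C / M := by ring
  -- second term
  have hnH2 : nH ^ 2 ≤ L ^ 2 * nz ^ 2 := by
    rw [← mul_pow]; exact pow_le_pow_left₀ hnH0.le hnH 2
  have t2 : (cmax ^ 2 * C₂ / (M * nz) ^ 2) * (nH ^ 2 / C) ≤ cmax ^ 2 * C₂ * L ^ 2 / C / M := by
    have hstep : (cmax ^ 2 * C₂ / (M * nz) ^ 2) * (nH ^ 2 / C) ≤ (cmax ^ 2 * C₂ / (M * nz) ^ 2) * (L ^ 2 * nz ^ 2 / C) :=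
      mul_le_mul_of_nonneg_left (div_le_div_of_nonneg_right hnH2 hC.le) (by positivity)
    refine hstep.trans ?_
    have e : (cmax ^ 2 * C₂ / (M * nz) ^ 2) * (L ^ 2 * nz ^ 2 / C) = cmax ^ 2 * C₂ * L ^ 2 / C / M * (1 / M) := by
      field_simp
    rw [e]
    have hbase : 0 ≤ cmax ^ 2 * C₂ * L ^ 2 / C / M := by positivity
    have h1M : 1 / M ≤ 1 := by rw [div_le_one hM0]; exact hM
    calc cmax ^ 2 * C₂ * L ^ 2 / C / M * (1 / M) ≤ cmax ^ 2 * C₂ * L ^ 2 / C / M * 1 :=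
          mul_le_mul_of_nonneg_left h1M hbase
      _ = cmax ^ 2 * C₂ * L ^ 2 / C / M := mul_one _
  have t3 : Γ * (nH ^ 2 / C) ≤ 2 * amax * C₃ * L ^ 2 / C / M := by
    have hstep : Γ * (nH ^ 2 / C) ≤ (2 * amax * C₃ / (M * nz ^ 2)) * (L ^ 2 * nz ^ 2 / C) :=
      mul_le_mul hΓ (div_le_div_of_nonneg_right hnH2 hC.le) (by positivity) (by positivity)
    refine hstep.trans (le_of_eq ?_)
    field_simp
  have hsum : (cmax ^ 2 * C₂ / (M * nz) ^ 2 + Γ) * (nH ^ 2 / C) =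
      (cmax ^ 2 * C₂ / (M * nz) ^ 2) * (nH ^ 2 / C) + Γ * (nH ^ 2 / C) := by ring
  rw [hsum]
  have etot : (2 * cmax * C₁ * Real.sqrt dd * L / Real.sqrt C + cmax ^ 2 * C₂ * L ^ 2 / C + 2 * amax * C₃ * L ^ 2 / C) / M =
      2 * cmax * C₁ * Real.sqrt dd * L / Real.sqrt C / M + cmax ^ 2 * C₂ * L ^ 2 / C / M + 2 * amax * C₃ * L ^ 2 / C / M := by
    ring
  rw [etot]
  linarith

/-- MODEL bookkeeping: **the level-free remainder constant**
`C_rem = 2c_maxC₁√d·L/√C + c_max²C₂L²/C + 2a_maxC₃L²/C` — sees `d, c_max, a_max, C, L, C₁, C₂, C₃` only. [folklore] -/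
def remConst (d : ℕ) (cmax amax C L C₁ C₂ C₃ : ℝ) : ℝ :=
  2 * cmax * C₁ * Real.sqrt d * L / Real.sqrt C + cmax ^ 2 * C₂ * L ^ 2 / C + 2 * amax * C₃ * L ^ 2 / C

omit [∀ i, NeZero (N i)] [Fintype Cp] [DecidableEq Cp] [Fintype J] [Fintype K] in
/-- `C_rem ≥ 0`. [folklore] -/
theorem remConst_nonneg (d : ℕ) {cmax amax C L C₁ C₂ C₃ : ℝ} (hcmax : 0 ≤ cmax) (hamax : 0 ≤ amax) (hC : 0 < C)
    (hL : 0 ≤ L) (hC₁ : 0 ≤ C₁) (hC₂ : 0 ≤ C₂) (hC₃ : 0 ≤ C₃) : 0 ≤ remConst d cmax amax C L C₁ C₂ C₃ := by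
  unfold remConst
  have : 0 < Real.sqrt C := Real.sqrt_pos.mpr hC
  positivity

/-- **THE REMAINDER TERM IS O(1/M), LEVEL-FREE (MODEL; node (w4-b′)).**  Under the hypotheses of `remainder_le_torus` with
SCALE-ADAPTED data — box scale `n_z ≥ 1`, hull scale `n_H ≤ L·n_z`, `|c∂h| ≤ c_maxC₁/(M n_z)`, `|Δ_c h| ≤ c_max²C₂/(M n_z)²`,
averaging oscillation budget `Σ_l |a_l|·2ω̄_l²S_l^d·m_l ≤ 2a_maxC₃/(M n_z²)`, `M ≥ 1` —
**`‖K(h)G′_{Ω₀}M_h‖_{ℓ²} ≤ C_rem/M`** with `C_rem = remConst d c_max a_max C L C₁ C₂ C₃`: nothing depends on the box scale, the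
levels, their number or the volume ([B6] (2.40) «O(M⁻¹)» / [B9] (3.89) SHAPE).
[cite: Balaban1985BackgroundPropagators, (3.88)–(3.89) p.409; Balaban1984PropagatorsII, (2.39)–(2.40) pp.229–230] -/
theorem remainder_le_torus_adapted
    (hdisj : ∀ k k' v v', cellPt S hS hdivS lvl zc k v = cellPt S hS hdivS lvl zc k' v' → k = k')
    (hcover : ∀ x : UT N, ∃ k, ∃ v : Box d (S (lvl k)), cellPt S hS hdivS lvl zc k v = x)
    (hRm : ∀ b i j, ∑ k, Rm b k i * Rm b k j = if i = j then (1 : ℝ) else 0)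
    (hT : ∀ l x i i', ∑ k, T l x k i * T l x k i' = if i = i' then (1 : ℝ) else 0) (ha : ∀ j, 0 ≤ a j)
    {wmax : J → ℝ} (hw0 : ∀ l, 0 ≤ wmax l) (hw : ∀ l x, |ω l (ctrU N (S l) (tblk (hS l) (hdivS l) x))| ≤ wmax l)
    {cmax : ℝ} (hcmax : 0 ≤ cmax) {C : ℝ} (hC : 0 < C)
    (hcoer : ∀ f : UT N × Cp → ℝ,
      C * ∑ k, ((S (lvl k) : ℝ) ^ 2)⁻¹ * ∑ v : Box d (S (lvl k)), ∑ i, f (cellPt S hS hdivS lvl zc k v, i) ^ 2 ≤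
        ∑ p, f p * levelOp bsrc btgt c Rm (fun l x => ctrU N (S l) (tblk (hS l) (hdivS l) x))
          (fun l x => ω l (ctrU N (S l) (tblk (hS l) (hdivS l) x))) T a f p)
    {M L amax C₁ C₂ C₃ : ℝ} (hM : 1 ≤ M) (hL : 1 ≤ L) (hamax : 0 ≤ amax) (hC₁ : 0 ≤ C₁) (hC₂ : 0 ≤ C₂) (hC₃ : 0 ≤ C₃)
    (χ : UT N → ℝ) (hχ : ∀ x, χ x = 0 ∨ χ x = 1) {nz nH : ℕ} (hnz : 1 ≤ nz) (hnH : 1 ≤ nH) (hHL : (nH : ℝ) ≤ L * nz)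
    (hH : ∀ x, χ x = 1 → siteScale S hS hdivS lvl zc hcover x ≤ nH)
    (h : UT N → ℝ) (hh : ∀ x, |h x| ≤ 1) (hdh : ∀ b, |c b * (h (btgt b) - h (bsrc b))| ≤ cmax * C₁ / (M * nz))
    (hlap : ∀ x, |lapH bsrc btgt c h x| ≤ cmax ^ 2 * C₂ / (M * nz) ^ 2) {m : J → ℝ} (hm : ∀ l, 0 ≤ m l)
    (hosc : ∀ l x, ω l (ctrU N (S l) (tblk (hS l) (hdivS l) x)) ≠ 0 → |h x - h (ctrU N (S l) (tblk (hS l) (hdivS l) x))| ≤ m l)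
    (hmsum : ∑ l, |a l| * (2 * (wmax l ^ 2 * ((S l ^ d : ℕ) : ℝ)) * m l) ≤ 2 * amax * C₃ / (M * (nz : ℝ) ^ 2)) :
    L2Bound (remK bsrc btgt c Rm (levelSum (fun l x => ctrU N (S l) (tblk (hS l) (hdivS l) x))
          (fun l x => ω l (ctrU N (S l) (tblk (hS l) (hdivS l) x))) T a) h *
        dirInv (levelOp bsrc btgt c Rm (fun l x => ctrU N (S l) (tblk (hS l) (hdivS l) x))
          (fun l x => ω l (ctrU N (S l) (tblk (hS l) (hdivS l) x))) T a) (χ ∘ Prod.fst) * mulOp (h ∘ Prod.fst))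
      (remConst d cmax amax C L C₁ C₂ C₃ / M) := by
  have hM0 : 0 < M := by linarith
  have hnz0 : (0 : ℝ) < nz := by exact_mod_cast hnz
  have hθ : 0 ≤ cmax * C₁ / (M * nz) := by positivity
  have hΘ₂ : 0 ≤ cmax ^ 2 * C₂ / (M * nz) ^ 2 := by positivity
  have hmain := remainder_le_torus S hS hdivS lvl zc Rm T a ω c hdisj hcover hRm hT ha hw0 hw hC hcoer χ hχ hnH hH
    h hh hθ hdh hΘ₂ hlap hm hosc
  refine hmain.mono ?_
  have := adapted_arith (dd := (d : ℝ)) hM (show (1 : ℝ) ≤ nz by exact_mod_cast hnz) hL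
    (show (0 : ℝ) < nH by exact_mod_cast hnH) hHL hC hcmax hamax hC₁ hC₂ hC₃ hmsum
  unfold remConst
  exact this

end Remainder

/-! ## §4  The parametrix on the torus with a level-free threshold -/

section Parametrix

variable (Rm : UT N × Fin d → Cp → Cp → ℝ) (T : J → UT N → Cp → Cp → ℝ) (a : J → ℝ) (ω : J → UT N → ℝ)
  (c : UT N × Fin d → ℝ)

/-- **THE PARAMETRIX OF THE MULTI-REGION OPERATOR ON THE TORUS WITH A LEVEL-FREE THRESHOLD (MODEL; node (w4-c′)).**  A finite
family of boxes `z` with bumps `h_z` (`Σ_z h_z² = 1`) and hulls `χ_z` as in `remainder_le_torus_adapted` (each hull a union of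
family cells, constant `χ_z` on cells, carrying `supp h_z` with its bond-neighbourhood; scale-adapted data with the SAME
`L, C₁, C₂, C₃`), at most `ν` hulls through a site, and **`ν·C_rem < M`**: `1 − R′` is a unit, **`A⁻¹ = G′₀·(1 − R′)⁻¹`** and
**`‖(1 − R′)⁻¹‖_{ℓ²} ≤ (1 − C_rem ν/M)⁻¹`** — the Thm 3.7 / (2.38) resolvent whose «M sufficiently large» sees
`d, c_max, a_max, C, L, C₁, C₂, C₃, ν` only. [cite: Balaban1985BackgroundPropagators, (3.87)–(3.90) pp.408–409 + Thm 3.7; Balaban1984PropagatorsII, (2.36)–(2.38) p.229] -/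
theorem parametrix_torus_adapted {ι : Type} [Fintype ι]
    (hdisj : ∀ k k' v v', cellPt S hS hdivS lvl zc k v = cellPt S hS hdivS lvl zc k' v' → k = k')
    (hcover : ∀ x : UT N, ∃ k, ∃ v : Box d (S (lvl k)), cellPt S hS hdivS lvl zc k v = x)
    (hRm : ∀ b i j, ∑ k, Rm b k i * Rm b k j = if i = j then (1 : ℝ) else 0)
    (hT : ∀ l x i i', ∑ k, T l x k i * T l x k i' = if i = i' then (1 : ℝ) else 0) (ha : ∀ j, 0 ≤ a j)
    (hsupp : ∀ l x, ω l (ctrU N (S l) (tblk (hS l) (hdivS l) x)) ≠ 0 → ∃ k v, lvl k = l ∧ cellPt S hS hdivS lvl zc k v = x)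
    {wmax : J → ℝ} (hw0 : ∀ l, 0 ≤ wmax l) (hw : ∀ l x, |ω l (ctrU N (S l) (tblk (hS l) (hdivS l) x))| ≤ wmax l)
    {cmax : ℝ} (hcmax : 0 ≤ cmax) {C : ℝ} (hC : 0 < C)
    (hcoer : ∀ f : UT N × Cp → ℝ,
      C * ∑ k, ((S (lvl k) : ℝ) ^ 2)⁻¹ * ∑ v : Box d (S (lvl k)), ∑ i, f (cellPt S hS hdivS lvl zc k v, i) ^ 2 ≤
        ∑ p, f p * levelOp bsrc btgt c Rm (fun l x => ctrU N (S l) (tblk (hS l) (hdivS l) x))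
          (fun l x => ω l (ctrU N (S l) (tblk (hS l) (hdivS l) x))) T a f p)
    {M L amax C₁ C₂ C₃ : ℝ} (hM : 1 ≤ M) (hL : 1 ≤ L) (hamax : 0 ≤ amax) (hC₁ : 0 ≤ C₁) (hC₂ : 0 ≤ C₂) (hC₃ : 0 ≤ C₃)
    (hs : ι → UT N → ℝ) (hsq : ∀ x, ∑ z, hs z x ^ 2 = 1) (hh : ∀ z x, |hs z x| ≤ 1)
    (χ : ι → UT N → ℝ) (hχ : ∀ z x, χ z x = 0 ∨ χ z x = 1)
    (hχcell : ∀ z k v, χ z (cellPt S hS hdivS lvl zc k v) = χ z (ctrU N (S (lvl k)) (zc k)))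
    (hsite : ∀ z x, hs z x ≠ 0 → χ z x = 1)
    (hbond : ∀ z b, (hs z (bsrc b) ≠ 0 ∨ hs z (btgt b) ≠ 0) → χ z (bsrc b) = 1 ∧ χ z (btgt b) = 1)
    (nz nH : ι → ℕ) (hnz : ∀ z, 1 ≤ nz z) (hnH : ∀ z, 1 ≤ nH z) (hHL : ∀ z, (nH z : ℝ) ≤ L * nz z)
    (hH : ∀ z x, χ z x = 1 → siteScale S hS hdivS lvl zc hcover x ≤ nH z)
    (hdh : ∀ z b, |c b * (hs z (btgt b) - hs z (bsrc b))| ≤ cmax * C₁ / (M * nz z))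
    (hlap : ∀ z x, |lapH bsrc btgt c (hs z) x| ≤ cmax ^ 2 * C₂ / (M * nz z) ^ 2) (m : ι → J → ℝ) (hm : ∀ z l, 0 ≤ m z l)
    (hosc : ∀ z l x, ω l (ctrU N (S l) (tblk (hS l) (hdivS l) x)) ≠ 0 →
      |hs z x - hs z (ctrU N (S l) (tblk (hS l) (hdivS l) x))| ≤ m z l)
    (hmsum : ∀ z, ∑ l, |a l| * (2 * (wmax l ^ 2 * ((S l ^ d : ℕ) : ℝ)) * m z l) ≤ 2 * amax * C₃ / (M * (nz z : ℝ) ^ 2))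
    {ν : ℝ} (hν0 : 0 ≤ ν) (hν : ∀ x, ∑ z, χ z x ≤ ν) (hsmall : remConst d cmax amax C L C₁ C₂ C₃ / M * ν < 1) :
    IsUnit (1 - Rsum bsrc btgt c Rm
        (levelSum (fun l x => ctrU N (S l) (tblk (hS l) (hdivS l) x)) (fun l x => ω l (ctrU N (S l) (tblk (hS l) (hdivS l) x))) T a)
        (levelOp bsrc btgt c Rm (fun l x => ctrU N (S l) (tblk (hS l) (hdivS l) x))
          (fun l x => ω l (ctrU N (S l) (tblk (hS l) (hdivS l) x))) T a) hs χ) ∧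
      Ring.inverse (levelOp bsrc btgt c Rm (fun l x => ctrU N (S l) (tblk (hS l) (hdivS l) x))
          (fun l x => ω l (ctrU N (S l) (tblk (hS l) (hdivS l) x))) T a) =
        G0sum (levelOp bsrc btgt c Rm (fun l x => ctrU N (S l) (tblk (hS l) (hdivS l) x))
          (fun l x => ω l (ctrU N (S l) (tblk (hS l) (hdivS l) x))) T a) hs χ *
        Ring.inverse (1 - Rsum bsrc btgt c Rm
          (levelSum (fun l x => ctrU N (S l) (tblk (hS l) (hdivS l) x)) (fun l x => ω l (ctrU N (S l) (tblk (hS l) (hdivS l) x))) T a)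
          (levelOp bsrc btgt c Rm (fun l x => ctrU N (S l) (tblk (hS l) (hdivS l) x))
            (fun l x => ω l (ctrU N (S l) (tblk (hS l) (hdivS l) x))) T a) hs χ) ∧
      L2Bound (Ring.inverse (1 - Rsum bsrc btgt c Rm
          (levelSum (fun l x => ctrU N (S l) (tblk (hS l) (hdivS l) x)) (fun l x => ω l (ctrU N (S l) (tblk (hS l) (hdivS l) x))) T a)
          (levelOp bsrc btgt c Rm (fun l x => ctrU N (S l) (tblk (hS l) (hdivS l) x))
            (fun l x => ω l (ctrU N (S l) (tblk (hS l) (hdivS l) x))) T a) hs χ))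
        (1 - remConst d cmax amax C L C₁ C₂ C₃ / M * ν)⁻¹ := by
  have hpos := posDef_of_coercive S hS hdivS lvl zc hdisj hcover _ hC hcoer
  have hq₀ : 0 ≤ remConst d cmax amax C L C₁ C₂ C₃ / M :=
    div_nonneg (remConst_nonneg d hcmax hamax hC (by linarith) hC₁ hC₂ hC₃) (by linarith)
  have hS' := fun z => remainder_le_torus_adapted S hS hdivS lvl zc Rm T a ω c hdisj hcover hRm hT ha hw0 hw hcmax hC
    hcoer hM hL hamax hC₁ hC₂ hC₃ (χ z) (hχ z) (hnz z) (hnH z) (hHL z) (hH z) (hs z) (hh z) (hdh z) (hlap z) (hm z)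
    (hosc z) (hmsum z)
  exact parametrix_levelOp bsrc btgt c Rm (fun l x => ctrU N (S l) (tblk (hS l) (hdivS l) x))
    (fun l x => ω l (ctrU N (S l) (tblk (hS l) (hdivS l) x))) T a hpos hs hsq χ hχ hsite hbond
    (fun z l β => χ z β) (fun z l x hx => blockConst_of_cellConst S hS hdivS lvl zc ω hsupp (χ z) (hχcell z) l x hx)
    hq₀ hS' hν0 hν hsmall

end Parametrix

end

end Summit.QuantumFields.BalabanUV.Beta.MultiscaleParametrixTorus
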